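import Literature.AlgebraicGeometry.Frobenioids.PadicKummerThm24iBaseKernel
import Literature.AlgebraicGeometry.Frobenioids.PadicFrobenioidBaseGaloisSystemPushIso
import HarnessLib

/-!
# Frobenioids II, Theorem 2.4 (i) over GENERAL bases from an EQUIVALENCE of bases `Ψ_Base : D₁ ⥲ D₂` alone:
# `θ`, `εF`, `hkerθ` all internal

Mochizuki, *The geometry of Frobenioids II*, Kyushu J. Math. **62** (2008) 401–460, §2, Theorem 2.4 p. 19
[cite: MochizukiFrdII2008, Thm 2.4 (i) p.19]: "an equivalence of categories `Ψ : C₁ ⥲ C₂` — which … necessarily induces a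
1-compatible equivalence of categories `Ψ_Base : D₁ ⥲ D₂`, hence an outer isomorphism of topological groups `Π₁ ⥲ Π₂`
[cf. [Mzk2], Proposition 3.2] that lies over an outer isomorphism of topological groups `G₁ ⥲ G₂` [cf. Theorem 1.2, (ii)].
Assume that this isomorphism `G₁ ⥲ G₂` maps `H₁` onto `H₂`. Then … (i) …".

Capstone (seat abc-iut-L1-t7, gen 6) of the base-step chain `PadicFrobenioidBaseGaloisSystemPush(Iso)` →
`PadicKummerThm24iFrobenioidRelBase` → `PadicKummerThm24iBaseKernel`: from the printed hypothesis alone — an EQUIVALENCE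
`Ψ_Base : D₁ ⥲ D₂` of the small bases `Dᵢ = RelCosetCat Πᵢ°` together with the 1-compatibility `η : Ψ ⋙ Base₂ ≅ Base₁ ⋙ Ψ_Base`
([FrdI] Thm. 3.4 (v) / [FrdII] Thm. 1.2 (i), BY NAME) — we CHOOSE

* `thetaOfBase : Π₁ →* Π₂`, continuous, open, bijective (`continuous_thetaOfBase`, `isOpenMap_thetaOfBase`,
  `bijective_thetaOfBase`) — a representative of print's "outer isomorphism of topological groups `Π₁ ⥲ Π₂`", and
* `basePushIsoOfBase : Ψ ⋙ Base₂ ⋙ incl ≅ Base₁ ⋙ incl ⋙ (thetaOfBase)_*` — "`Ψ_Base = θ_*` 1-compatibly",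

(existence: `exists_theta_basePushIso`, i.e. `BaseGaloisSystem.exists_hom_pushIso_of_relCosetCat_equivalence` whiskered
with `η`), and derive "lies over `G₁ ⥲ G₂`" (`hker_thetaOfBase`, from `hker_of_basePush` = Theorem 1.2 (ii)).  Whence
**`thm24i_ofFunctorRel_ofBaseEquivalence`: Theorem 2.4 (i) for the `p`-adic Frobenioids over GENERAL bases
`B^temp(Πᵢ, Πᵢ°)⁰` modulo EXACTLY the printed named inputs {hO "`Ψ` preserves `O^⊳`" ([FrdI] Cor. 4.10/4.11), `Ψ_Base` + `η`,
map_H ("this isomorphism `G₁ ⥲ G₂` maps `H₁` onto `H₂`" — printed ASSUMPTION, for the representative `isoGOfTheta`), hfs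
(row L03)}** — with `θ`, `e`, `compat`, `hkerθ`, `isoG`, `houter`, `hbase`, `p₁ = p₂`, … all CONSTRUCTED or PROVED.

Classical bookkeeping over landed files; nothing here concerns [IUTchIII]; no statement of the paper is strengthened.
-/

noncomputable section

namespace Literature.AlgebraicGeometry.Frobenioids

namespace PadicFrd

namespace RelGal

open CategoryTheory Function Literature.AnabelianGeometry.SemiGraphs QuasiTemperoid

/-! ### §1 Choosing `θ` and `εF` from `Ψ_Base`, `η` -/

section Choose

variable {p₁ p₂ : ℕ} [Fact p₁.Prime] [Fact p₂.Prime]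
  {P₁ : Type} [Group P₁] [TopologicalSpace P₁] [IsTopologicalGroup P₁] [SecondCountableTopology P₁]
  (hP₁ : IsTempered P₁) {P₁₀ : OpenSubgroup P₁} {d₁ : Datum (RelCosetCat P₁₀) p₁}
  {P₂ : Type} [Group P₂] [TopologicalSpace P₂] [IsTopologicalGroup P₂] (hP₂ : IsTempered P₂) {P₂₀ : OpenSubgroup P₂}
  {d₂ : Datum (RelCosetCat P₂₀) p₂}
  (F : d₁.frobenioid ⥤ d₂.frobenioid) (ΨB : RelCosetCat P₁₀ ≌ RelCosetCat P₂₀)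
  (η : F ⋙ ModelFrobenioid.baseFunctor d₂.Φ d₂.B d₂.divB ≅ ModelFrobenioid.baseFunctor d₁.Φ d₁.B d₁.divB ⋙ ΨB.functor)

include hP₁ hP₂ η in
/-- **From `Ψ_Base` an EQUIVALENCE and `η`: a continuous open bijective `θ : Π₁ → Π₂` with `Ψ ⋙ Base₂ ⋙ incl ≅ Base₁ ⋙ incl ⋙ θ_*`**
(`BaseGaloisSystem.exists_hom_pushIso_of_relCosetCat_equivalence` + `basePushIso`). [cite: MochizukiFrdII2008, Thm 2.4 (i) p.19] -/
theorem exists_theta_basePushIso :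
    ∃ (θ : P₁ →* P₂) (_ : Continuous θ) (hθo : IsOpenMap θ) (_ : Bijective θ),
      Nonempty (F ⋙ ModelFrobenioid.baseFunctor d₂.Φ d₂.B d₂.divB ⋙ RelCosetCat.incl P₂₀ ≅
        ModelFrobenioid.baseFunctor d₁.Φ d₁.B d₁.divB ⋙ RelCosetCat.incl P₁₀ ⋙ CosetCat.push θ hθo) := by
  obtain ⟨θ, hθc, hθo, hθb, ⟨ε⟩, -⟩ :=
    BaseGaloisSystem.exists_hom_pushIso_of_relCosetCat_equivalence hP₁ P₁₀ hP₂ P₂₀ ΨB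
  exact ⟨θ, hθc, hθo, hθb, ⟨basePushIso F ΨB.functor η θ hθo ε⟩⟩

/-- **THE representative `θ : Π₁ → Π₂`** of the outer isomorphism of topological groups induced by `Ψ_Base` (chosen).
[cite: MochizukiFrdII2008, Thm 2.4 (i) p.19] -/
def thetaOfBase : P₁ →* P₂ := (exists_theta_basePushIso hP₁ hP₂ F ΨB η).choose

/-- `θ` is continuous. [cite: MochizukiFrdII2008, Thm 2.4 (i) p.19] -/
theorem continuous_thetaOfBase : Continuous (thetaOfBase hP₁ hP₂ F ΨB η) :=
  (exists_theta_basePushIso hP₁ hP₂ F ΨB η).choose_spec.choose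

/-- `θ` is open. [cite: MochizukiFrdII2008, Thm 2.4 (i) p.19] -/
theorem isOpenMap_thetaOfBase : IsOpenMap (thetaOfBase hP₁ hP₂ F ΨB η) :=
  (exists_theta_basePushIso hP₁ hP₂ F ΨB η).choose_spec.choose_spec.choose

/-- `θ` is bijective. [cite: MochizukiFrdII2008, Thm 2.4 (i) p.19] -/
theorem bijective_thetaOfBase : Bijective (thetaOfBase hP₁ hP₂ F ΨB η) :=
  (exists_theta_basePushIso hP₁ hP₂ F ΨB η).choose_spec.choose_spec.choose_spec.choose

/-- **`Ψ ⋙ Base₂ ⋙ incl ≅ Base₁ ⋙ incl ⋙ θ_*`** for the chosen `θ` (chosen). [cite: MochizukiFrdII2008, Thm 2.4 (i) p.19] -/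
def basePushIsoOfBase :
    F ⋙ ModelFrobenioid.baseFunctor d₂.Φ d₂.B d₂.divB ⋙ RelCosetCat.incl P₂₀ ≅
      ModelFrobenioid.baseFunctor d₁.Φ d₁.B d₁.divB ⋙ RelCosetCat.incl P₁₀ ⋙
        CosetCat.push (thetaOfBase hP₁ hP₂ F ΨB η) (isOpenMap_thetaOfBase hP₁ hP₂ F ΨB η) :=
  (exists_theta_basePushIso hP₁ hP₂ F ΨB η).choose_spec.choose_spec.choose_spec.choose_spec.some

end Choose

/-! ### §2 "lies over `G₁ ⥲ G₂`" for the chosen `θ` -/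

section Kernel

variable {p₁ p₂ : ℕ} [Fact p₁.Prime] [Fact p₂.Prime]
  {P₁ : Type} [Group P₁] [TopologicalSpace P₁] [IsTopologicalGroup P₁] [SecondCountableTopology P₁]
  (hP₁ : IsTempered P₁) (φ₁ : P₁ →* GalFbar ℚ_[p₁]) (hφ₁ : IsOpenHom φ₁) {P₁₀ : OpenSubgroup P₁}
  {d₁ : Datum (RelCosetCat P₁₀) p₁} (hd₁ : d₁.base = relBaseGal p₁ P₁₀ φ₁ hφ₁)
  {P₂ : Type} [Group P₂] [TopologicalSpace P₂] [IsTopologicalGroup P₂] (hP₂ : IsTempered P₂)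
  (φ₂ : P₂ →* GalFbar ℚ_[p₂]) (hφ₂ : IsOpenHom φ₂) {P₂₀ : OpenSubgroup P₂}
  {d₂ : Datum (RelCosetCat P₂₀) p₂} (hd₂ : d₂.base = relBaseGal p₂ P₂₀ φ₂ hφ₂)
  (F : d₁.frobenioid ⥤ d₂.frobenioid) [F.Full] [F.Faithful] (ΨB : RelCosetCat P₁₀ ≌ RelCosetCat P₂₀)
  (η : F ⋙ ModelFrobenioid.baseFunctor d₂.Φ d₂.B d₂.divB ≅ ModelFrobenioid.baseFunctor d₁.Φ d₁.B d₁.divB ⋙ ΨB.functor)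
  (hO : ∀ (A : d₁.frobenioid) (f : A ⟶ A), f ∈ PreFrobenioid.endSubmonoid d₁.structureFunctor A ↔
    F.map f ∈ PreFrobenioid.endSubmonoid d₂.structureFunctor (F.obj A))

include hd₁ hd₂ hO in
/-- **The chosen `θ` lies over `G₁ ⥲ G₂`**: `Ker(Π₁ → G_{ℚ_{p₁}}) = θ⁻¹(Ker(Π₂ → G_{ℚ_{p₂}}))` (`hker_of_basePush`, Theorem 1.2 (ii)).
[cite: MochizukiFrdII2008, Thm 2.4 (i) p.19] -/
theorem hker_thetaOfBase (x : P₁) : φ₁ x = 1 ↔ φ₂ (thetaOfBase hP₁ hP₂ F ΨB η x) = 1 :=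
  hker_of_basePush hP₁ φ₁ hφ₁ hd₁ φ₂ hφ₂ hd₂ F hO (thetaOfBase hP₁ hP₂ F ΨB η) (continuous_thetaOfBase hP₁ hP₂ F ΨB η)
    (isOpenMap_thetaOfBase hP₁ hP₂ F ΨB η) (bijective_thetaOfBase hP₁ hP₂ F ΨB η).2
    (basePushIsoOfBase hP₁ hP₂ F ΨB η) x

end Kernel

end RelGal

end PadicFrd

/-! ### §3 Theorem 2.4 (i) over general bases from `Ψ_Base`, `η` -/

namespace PadicKummer.Def22Context

open CategoryTheory Field IntermediateField Kummer Function
open Literature.NumberTheory.GaloisRepresentations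
open Literature.AnabelianGeometry.SemiGraphs QuasiTemperoid PadicFrd PadicFrd.Datum PadicFrd.Datum.GaloisChart PadicFrd.RelGal

variable {p₁ p₂ : ℕ} [Fact p₁.Prime] [Fact p₂.Prime]
  {P₁ : Type} [Group P₁] [TopologicalSpace P₁] [IsTopologicalGroup P₁] [SecondCountableTopology P₁] (hP₁ : IsTempered P₁)
  {φ₁ : P₁ →* GalFbar ℚ_[p₁]} {hφ₁ : IsOpenHom φ₁} {P₁₀ : OpenSubgroup P₁}
  {d₁ : PadicFrd.Datum (RelCosetCat P₁₀) p₁} (hd₁ : d₁.base = relBaseGal p₁ P₁₀ φ₁ hφ₁)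
  {P₂ : Type} [Group P₂] [TopologicalSpace P₂] [IsTopologicalGroup P₂] (hP₂ : IsTempered P₂)
  {φ₂ : P₂ →* GalFbar ℚ_[p₂]} {hφ₂ : IsOpenHom φ₂} {P₂₀ : OpenSubgroup P₂}
  {d₂ : PadicFrd.Datum (RelCosetCat P₂₀) p₂} (hd₂ : d₂.base = relBaseGal p₂ P₂₀ φ₂ hφ₂)
  (F : d₁.frobenioid ⥤ d₂.frobenioid) [F.Full] [F.Faithful] (ΨB : RelCosetCat P₁₀ ≌ RelCosetCat P₂₀)
  (η : F ⋙ ModelFrobenioid.baseFunctor d₂.Φ d₂.B d₂.divB ≅ ModelFrobenioid.baseFunctor d₁.Φ d₁.B d₁.divB ⋙ ΨB.functor)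
  (hO : ∀ (A : d₁.frobenioid) (f : A ⟶ A), f ∈ PreFrobenioid.endSubmonoid d₁.structureFunctor A ↔
    F.map f ∈ PreFrobenioid.endSubmonoid d₂.structureFunctor (F.obj A))
  {A₁ : d₁.frobenioid} (hA₁ : A₁.base.obj.sg.toSubgroup.Normal) (hA₂ : (F.obj A₁).base.obj.sg.toSubgroup.Normal)
  {H₁ : Subgroup (absoluteGaloisGroup (baseFld p₁ φ₁ hφ₁))} [H₁.Normal]
  {hH₁ : IsOpen (H₁ : Set (absoluteGaloisGroup (baseFld p₁ φ₁ hφ₁)))}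
  {H₂ : Subgroup (absoluteGaloisGroup (baseFld p₂ φ₂ hφ₂))} [H₂.Normal]
  {hH₂ : IsOpen (H₂ : Set (absoluteGaloisGroup (baseFld p₂ φ₂ hφ₂)))}
  (map_H : H₁.map (isoGOfTheta φ₁ hφ₁ φ₂ hφ₂ F (thetaOfBase hP₁ hP₂ F ΨB η) (continuous_thetaOfBase hP₁ hP₂ F ΨB η)
    (isOpenMap_thetaOfBase hP₁ hP₂ F ΨB η) (bijective_thetaOfBase hP₁ hP₂ F ΨB η).2
    (hker_thetaOfBase hP₁ φ₁ hφ₁ hd₁ hP₂ φ₂ hφ₂ hd₂ F ΨB η hO)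
    (baseIsoOfPush F (thetaOfBase hP₁ hP₂ F ΨB η) (isOpenMap_thetaOfBase hP₁ hP₂ F ΨB η)
      (basePushIsoOfBase hP₁ hP₂ F ΨB η) A₁)).toMulEquiv.toMonoidHom = H₂)
  (N : ℕ) [NeZero N]
  (hμ₁ : ∀ ζ : rootsOfUnity N (AlgebraicClosure (baseFld p₁ φ₁ hφ₁)),
    ((ζ : (AlgebraicClosure (baseFld p₁ φ₁ hφ₁))ˣ) : AlgebraicClosure (baseFld p₁ φ₁ hφ₁)) ∈ objL φ₁ hφ₁ d₁ A₁)
  (hμ₂ : ∀ ζ : rootsOfUnity N (AlgebraicClosure (baseFld p₂ φ₂ hφ₂)),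
    ((ζ : (AlgebraicClosure (baseFld p₂ φ₂ hφ₂))ˣ) : AlgebraicClosure (baseFld p₂ φ₂ hφ₂)) ∈ objL φ₂ hφ₂ d₂ (F.obj A₁))

/-- **The isomorphism of Definition 2.2 contexts of `A₁`, `Ψ A₁` induced by `Ψ`, from `Ψ_Base`, `η` alone**
(`isoOfFunctorRelBasePush` at the chosen `θ`, `εF`, with `hkerθ := hker_thetaOfBase`). [cite: MochizukiFrdII2008, Thm 2.4 (i) p.19] -/
def isoOfFunctorRelBaseEquivalence :
    (contextOfObjectRel φ₁ hφ₁ d₁ hd₁ A₁ hA₁ H₁ hH₁).Iso (contextOfObjectRel φ₂ hφ₂ d₂ hd₂ (F.obj A₁) hA₂ H₂ hH₂) :=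
  isoOfFunctorRelBasePush hd₁ hd₂ F hA₁ hA₂ (hO A₁) (thetaOfBase hP₁ hP₂ F ΨB η) (continuous_thetaOfBase hP₁ hP₂ F ΨB η)
    (isOpenMap_thetaOfBase hP₁ hP₂ F ΨB η) (bijective_thetaOfBase hP₁ hP₂ F ΨB η).2
    (hker_thetaOfBase hP₁ φ₁ hφ₁ hd₁ hP₂ φ₂ hφ₂ hd₂ F ΨB η hO) (basePushIsoOfBase hP₁ hP₂ F ΨB η) map_H

/-- **[FrdII] Theorem 2.4 (i) for the `p`-adic Frobenioids over GENERAL bases `Dᵢ = B^temp(Πᵢ, Πᵢ°)⁰` (`Πᵢ` tempered, `Π₁`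
Galois-countable, `Πᵢ → G_{ℚ_{pᵢ}}` open homomorphisms), from the printed hypotheses BY NAME and nothing else structural.**
For `Ψ : C₁ ⥤ C₂` fully faithful with hO "`Ψ` preserves `O^⊳(−)`" ([FrdI] Cor. 4.10/4.11), an EQUIVALENCE of bases
`Ψ_Base : D₁ ⥲ D₂` with `η : Ψ ⋙ Base₂ ≅ Base₁ ⋙ Ψ_Base` ("necessarily induces a 1-compatible equivalence … `Ψ_Base`",
[FrdI] Thm. 3.4 (v)), an object `A₁` with `(A₁)_D`, `(Ψ A₁)_D` Galois, `μ_N(K̄ᵢ) ⊆ Lᵢ`, `A₁` `(N, H₁)`-saturated, any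
normalisation `F_N(A₁) ≅ ℤ/N`, map_H ("assume that this isomorphism `G₁ ⥲ G₂` maps `H₁` onto `H₂`", for the representative
`isoGOfTheta` at the CHOSEN `θ`) and hfs (row L03): the typed `Thm24i` holds for the contexts of `A₁`, `Ψ A₁`, the comparison
data induced by `Ψ` and the cup-product duality isomorphisms.  The outer isomorphism of TOPOLOGICAL groups `Π₁ ⥲ Π₂`
([SemiAnbd] Prop. 3.2), "`Ψ_Base = θ_*` 1-compatibly", "lies over `G₁ ⥲ G₂`" (Theorem 1.2 (ii)), `isoG`, `houter`, `hbase`,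
`p₁ = p₂`, local compactness, the saturation transfer and the Kummer/reciprocity compatibilities are all CONSTRUCTED or
PROVED in the tree. [cite: MochizukiFrdII2008, Thm 2.4 (i) p.19] -/
theorem thm24i_ofFunctorRel_ofBaseEquivalence (fs₁ fs₂ : Prop) (hfs : fs₁ ↔ fs₂)
    (eFN₁ : FN (contextOfObjectRel φ₁ hφ₁ d₁ hd₁ A₁ hA₁ H₁ hH₁) N ≃+ ZMod N)
    (hc₁ : IsNHSaturated (contextOfObjectRel φ₁ hφ₁ d₁ hd₁ A₁ hA₁ H₁ hH₁) N) :
    haveI := finiteDimensional_objL φ₁ hφ₁ d₁ A₁; haveI := normal_objL φ₁ hφ₁ d₁ A₁ hA₁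
    haveI := finiteDimensional_objL φ₂ hφ₂ d₂ (F.obj A₁); haveI := normal_objL φ₂ hφ₂ d₂ (F.obj A₁) hA₂
    haveI := finiteDimensional_baseFld p₁ φ₁ hφ₁; haveI := finiteDimensional_baseFld p₂ φ₂ hφ₂
    haveI := locallyCompactSpace_H_contextOfObjectRel φ₁ hφ₁ d₁ hd₁ A₁ hA₁ H₁ hH₁
    haveI := locallyCompactSpace_H_contextOfObjectRel φ₂ hφ₂ d₂ hd₂ (F.obj A₁) hA₂ H₂ hH₂
    letI := (galoisChartRel φ₁ hφ₁ d₁ hd₁ A₁ hA₁).galAction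
    letI := (galoisChartRel φ₂ hφ₂ d₂ hd₂ (F.obj A₁) hA₂).galAction
    Thm24i (contextOfObjectRel φ₁ hφ₁ d₁ hd₁ A₁ hA₁ H₁ hH₁) (contextOfObjectRel φ₂ hφ₂ d₂ hd₂ (F.obj A₁) hA₂ H₂ hH₂)
      N p₁ p₂ fs₁ fs₂
      ((isoOfFunctorRelBaseEquivalence hP₁ hd₁ hP₂ hd₂ F ΨB η hO hA₁ hA₂ map_H).thm24Data N)
      ((contextOfObjectRel φ₁ hφ₁ d₁ hd₁ A₁ hA₁ H₁ hH₁).dualityIsoOfLocalDuality N eFN₁ hc₁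
        (cupDualH_bijective_ofGalois_mlf p₁ (objL φ₁ hφ₁ d₁ A₁) H₁ hH₁ (galoisChartRel φ₁ hφ₁ d₁ hd₁ A₁ hA₁).res
          (galoisChartRel φ₁ hφ₁ d₁ hd₁ A₁ hA₁).res_smul ((galoisChartRel φ₁ hφ₁ d₁ hd₁ A₁ hA₁).muModel N hμ₁)))
      ((contextOfObjectRel φ₂ hφ₂ d₂ hd₂ (F.obj A₁) hA₂ H₂ hH₂).dualityIsoOfLocalDuality N
        (((isoOfFunctorRelBaseEquivalence hP₁ hd₁ hP₂ hd₂ F ΨB η hO hA₁ hA₂ map_H).isoFN N).symm.trans eFN₁)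
        (((isoOfFunctorRelBaseEquivalence hP₁ hd₁ hP₂ hd₂ F ΨB η hO hA₁ hA₂ map_H).isNHSaturated_iff N).mp hc₁)
        (cupDualH_bijective_ofGalois_mlf p₂ (objL φ₂ hφ₂ d₂ (F.obj A₁)) H₂ hH₂
          (galoisChartRel φ₂ hφ₂ d₂ hd₂ (F.obj A₁) hA₂).res (galoisChartRel φ₂ hφ₂ d₂ hd₂ (F.obj A₁) hA₂).res_smul
          ((galoisChartRel φ₂ hφ₂ d₂ hd₂ (F.obj A₁) hA₂).muModel N hμ₂))) :=
  thm24i_ofFunctorRel_ofBasePush hd₁ hd₂ F hA₁ hA₂ (hO A₁) (thetaOfBase hP₁ hP₂ F ΨB η)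
    (continuous_thetaOfBase hP₁ hP₂ F ΨB η) (isOpenMap_thetaOfBase hP₁ hP₂ F ΨB η) (bijective_thetaOfBase hP₁ hP₂ F ΨB η).2
    (hker_thetaOfBase hP₁ φ₁ hφ₁ hd₁ hP₂ φ₂ hφ₂ hd₂ F ΨB η hO) (basePushIsoOfBase hP₁ hP₂ F ΨB η) map_H N hμ₁ hμ₂
    fs₁ fs₂ hfs eFN₁ hc₁

end PadicKummer.Def22Context

end Literature.AlgebraicGeometry.Frobenioids

end
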